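import Literature.NumberTheory.Transcendental.OnePeriodsClosedPathsGenusZero
import Mathlib.FieldTheory.AlgebraicClosure
import Mathlib.Analysis.Complex.Polynomial.Basic
import HarnessLib

/-!
# Complete periods of plane curves: the conic slice of Huber–Wüstholz, Cor. 13.13, is a theorem

Companion of `Literature/NumberTheory/Transcendental/OnePeriodsClosedPaths.lean` (the named fact
`Literature.NumberTheory.Transcendental.completePlaneCurvePeriods_zero_or_transcendental`:
complete periods `S = Σᵢ nᵢ ∮_{γᵢ} (A dx + B dy)` of polynomial `1`-forms over `ℚ` along closed
`C¹` loops in the smooth locus of a plane curve `p = 0` over `ℚ` are `0` or transcendental;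
Huber–Wüstholz, *Transcendence and Linear Relations of 1-Periods*, Cambridge Tracts 227 (2022),
Cor. 13.13, p. 126 of the held text) and of `OnePeriodsClosedPathsGenusZero.lean` (the genus-`0`
engine: polynomially and Laurent-parametrised loops, Lindemann endgame).

Here the named fact is PROVED outright for every `p ∈ ℚ[x, y]` of total degree `≤ 2`
(`completePlaneCurvePeriods_zero_or_transcendental_of_totalDegree_le_two`), for all forms,
loops and multiplicities.  This is the complete degree-`2` (genus-`0`) content of the theorem,
whose only transcendence input is Lindemann's theorem (`transcendental_pi_holds`): Huber–Wüstholz,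
Remark 13.10 ("for genus `0` the theorem is the transcendence of `π`").  Classical instances: the
area `∮ x dy` of an ellipse over `ℚ` is transcendental (Lindemann 1882); complete periods on a
hyperbola or on a pair of lines vanish or are transcendental.

## The case analysis (`ClosedPathPeriods.completePeriods_eq_zero_of_conic`)

Write `p = a x² + b xy + c y² + d x + e y + f` (`exists_eq_conic_of_totalDegree_le_two`).
* `a = b = c = 0`: a line `d x + e y + f = 0` — every polynomial form restricts to an exact form,
  all complete periods vanish (`integral_form_eq_zero_of_line`); or `d = e = 0` and the smooth
  locus is empty.
* `b² = 4ac`, quadratic part `≠ 0`: in suitable affine coordinates `(ℓ, m)` over `ℚ` the curve is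
  `l ℓ² + μ ℓ + ν m + f = 0`; for `ν ≠ 0` a parabola, polynomially parametrised by `ℓ`
  (`integral_form_eq_zero_of_parabolaType`), for `ν = 0` two parallel lines — a loop stays on one
  of them by connectedness (`forall_or_forall_of_mul_eq_zero`) — or a double line, which has empty
  smooth locus (`integral_form_eq_zero_of_parallelType`).  All complete periods vanish.
* `b² ≠ 4ac`: the quadratic part factors over `ℚ(√(b² − 4ac)) ⊂ ℚ̄` into independent linear
  forms and `p = L₁ L₂ − E` with affine forms `L₁, L₂` over `ℚ̄` and `E ∈ ℚ̄`
  (`completePeriods_eq_zero_of_factoredConic`).  For `E = 0` two crossing lines (the crossing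
  point is singular, loops stay on one line); for `E ≠ 0` the curve is `𝔾_m` with coordinate
  `u = L₁`: `x, y` are affine in `u, u⁻¹` over `ℚ̄`, every polynomial form pulls back to a
  Laurent polynomial form over `ℚ̄`, and `∮_{γ} ω = c · wind(L₁∘γ) · 2πi` with ONE residue
  `c ∈ ℚ̄` for all loops (`exists_residue_of_central`, from
  `ClosedPathPeriods.integral_form_of_laurentParam`).  Hence `S = c W · 2πi` with `W ∈ ℤ`, and an
  algebraic `S` must vanish by Lindemann (`ClosedPathPeriods.eq_zero_of_isAlgebraic_mul_two_pi_I`).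

Coefficients in `ℚ̄` are handled inside the intermediate field `algebraicClosure ℚ ℂ`.

## References

* A. Huber, G. Wüstholz, *Transcendence and Linear Relations of 1-Periods*, Cambridge Tracts in
  Mathematics 227, CUP 2022, doi:10.1017/9781009019729 [HuberWustholz2022]: Cor. 13.13 (p. 126),
  Thm. 13.9 and Remark 13.10 (p. 125), Lemma 12.4 (p. 114).
* F. Lindemann, *Über die Zahl π*, Math. Ann. 20 (1882) [Lindemann1882]; A. Baker,
  *Transcendental Number Theory* (1975), Ch. 1, Thm. 1.3 [BakerTNT1975].
-/

noncomputable section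

open MvPolynomial Complex
open scoped Real Polynomial

namespace Literature.NumberTheory.Transcendental

namespace ClosedPathPeriods

open Literature.Topology.PlaneTopology Literature.Analysis.Complex

/-! ### Loops on lines, on pairs of lines, on parabolas -/

section Degenerate

variable {R : Type*} [CommRing R] [Algebra R ℂ]
variable {γ : ℝ → (Fin 2 → ℂ)}

/-- **Loops on a line `αx + βy + κ = 0` have zero complete periods** (`(α, β) ≠ (0, 0)`; a line
is a graph over one of the axes). [cite: HuberWustholz2022, Lemma 12.4 (p. 114)] -/
theorem integral_form_eq_zero_of_line (hγ : ContDiff ℝ 1 γ) (hper : Function.Periodic γ 1)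
    {α β κ : ℂ} (hαβ : ¬(α = 0 ∧ β = 0)) (hline : ∀ t, α * γ t 0 + β * γ t 1 + κ = 0)
    (A B : MvPolynomial (Fin 2) R) :
    (∫ t in (0:ℝ)..1, (aeval (γ t) A * deriv (fun s => γ s 0) t +
        aeval (γ t) B * deriv (fun s => γ s 1) t)) = 0 := by
  by_cases hβ : β = 0
  · have hα : α ≠ 0 := fun h => hαβ ⟨h, hβ⟩
    refine integral_form_eq_zero_of_graph' hγ hper (Polynomial.C (-κ / α)) (fun t => ?_) A B
    have h := hline t
    rw [hβ, zero_mul, add_zero] at h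
    rw [Polynomial.eval_C]
    field_simp
    linear_combination h
  · refine integral_form_eq_zero_of_graph hγ hper
      (Polynomial.C (-α / β) * Polynomial.X + Polynomial.C (-κ / β)) (fun t => ?_) A B
    have h := hline t
    simp only [Polynomial.eval_add, Polynomial.eval_mul, Polynomial.eval_C, Polynomial.eval_X]
    field_simp
    linear_combination h

omit [Algebra R ℂ] in
/-- **Dichotomy**: if two continuous functions `f, g : ℝ → ℂ` have `f g = 0` and never vanish
simultaneously, then one of them vanishes identically (`{f = 0}` is clopen in the connected
space `ℝ`).  Used for loops on a pair of lines: a loop stays on one of the lines. [folklore] -/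
theorem forall_or_forall_of_mul_eq_zero {f g : ℝ → ℂ} (hf : Continuous f) (hg : Continuous g)
    (hmul : ∀ t, f t * g t = 0) (hne : ∀ t, ¬(f t = 0 ∧ g t = 0)) :
    (∀ t, f t = 0) ∨ (∀ t, g t = 0) := by
  have hcl : IsClosed {t | f t = 0} := isClosed_eq hf continuous_const
  have hcompl : {t | f t = 0}ᶜ = {t | g t = 0} := by
    ext t
    simp only [Set.mem_compl_iff, Set.mem_setOf_eq]
    exact ⟨fun h => (mul_eq_zero.1 (hmul t)).resolve_left h, fun h hf0 => hne t ⟨hf0, h⟩⟩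
  have hop : IsOpen {t | f t = 0} := by
    rw [← isClosed_compl_iff, hcompl]
    exact isClosed_eq hg continuous_const
  rcases isClopen_iff.1 ⟨hcl, hop⟩ with h | h
  · right
    intro t
    have ht : t ∉ {t | f t = 0} := by
      rw [h]
      exact Set.notMem_empty t
    exact (mul_eq_zero.1 (hmul t)).resolve_left ht
  · left
    intro t
    have ht : t ∈ {t | f t = 0} := by
      rw [h]
      exact Set.mem_univ t
    exact ht

/-- A linear function of a `C¹` loop is continuous. [folklore] -/
theorem continuous_linear_loop (hγ : ContDiff ℝ 1 γ) (a b c : ℂ) :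
    Continuous fun t => a * γ t 0 + b * γ t 1 + c :=
  ((continuous_const.mul ((continuous_apply 0).comp hγ.continuous)).add
    (continuous_const.mul ((continuous_apply 1).comp hγ.continuous))).add continuous_const

/-- A linear function of a `C¹` loop is `C¹`. [folklore] -/
theorem contDiff_linear_loop (hγ : ContDiff ℝ 1 γ) (a b c : ℂ) :
    ContDiff ℝ 1 fun t => a * γ t 0 + b * γ t 1 + c :=
  ((contDiff_const.mul (contDiff_pi.1 hγ 0)).add
    (contDiff_const.mul (contDiff_pi.1 hγ 1))).add contDiff_const

/-- **Loops on a pair of parallel lines (or a double line) have zero complete periods.**  The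
curve is `l ℓ² + m ℓ + f₀ = 0` for a linear form `ℓ = αx + βy`, `(α, β) ≠ (0, 0)`, `l ≠ 0`; its
gradient is `(2lℓ + m)(α, β)`, so on the smooth locus `2lℓ + m ≠ 0`, which excludes the double
line; on two distinct parallel lines a loop stays on one of them. [cite: HuberWustholz2022, Lemma 12.4 (p. 114)] -/
theorem integral_form_eq_zero_of_parallelType (hγ : ContDiff ℝ 1 γ) (hper : Function.Periodic γ 1)
    {α β l m f₀ : ℂ} (hαβ : ¬(α = 0 ∧ β = 0)) (hl : l ≠ 0)
    (hon : ∀ t, l * (α * γ t 0 + β * γ t 1) ^ 2 + m * (α * γ t 0 + β * γ t 1) + f₀ = 0)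
    (hsm : ∀ t, 2 * l * (α * γ t 0 + β * γ t 1) + m ≠ 0)
    (A B : MvPolynomial (Fin 2) R) :
    (∫ t in (0:ℝ)..1, (aeval (γ t) A * deriv (fun s => γ s 0) t +
        aeval (γ t) B * deriv (fun s => γ s 1) t)) = 0 := by
  obtain ⟨s, hs⟩ := IsAlgClosed.exists_eq_mul_self (m ^ 2 - 4 * l * f₀)
  -- `4l (lℓ² + mℓ + f₀) = (2lℓ + m − s)(2lℓ + m + s)`
  have hfac : ∀ t, (2 * l * α * γ t 0 + 2 * l * β * γ t 1 + (m - s)) *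
      (2 * l * α * γ t 0 + 2 * l * β * γ t 1 + (m + s)) = 0 := fun t => by
    linear_combination (4 * l) * hon t + hs
  have h2l : ¬(2 * l * α = 0 ∧ 2 * l * β = 0) := by
    rintro ⟨h1, h2⟩
    refine hαβ ⟨?_, ?_⟩
    · simpa [hl] using h1
    · simpa [hl] using h2
  by_cases hs0 : s = 0
  · -- double line: excluded by smoothness
    exfalso
    have h := hfac 0
    rw [hs0, sub_zero, add_zero, mul_self_eq_zero] at h
    exact hsm 0 (by linear_combination h)
  · rcases forall_or_forall_of_mul_eq_zero (continuous_linear_loop hγ _ _ _)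
        (continuous_linear_loop hγ _ _ _) hfac (fun t ⟨h1, h2⟩ => hs0 (by
          linear_combination (h2 - h1) / 2)) with h | h
    · exact integral_form_eq_zero_of_line hγ hper h2l h A B
    · exact integral_form_eq_zero_of_line hγ hper h2l h A B

/-- **Loops on a parabola have zero complete periods.**  In affine coordinates
`(θ, μ) = (αx + βy, α′x + β′y)` (`αβ′ − α′β ≠ 0`) the curve is a graph `μ = g(θ)`, `g ∈ ℂ[s]`,
so the loop is polynomially parametrised by `θ`. [cite: HuberWustholz2022, Lemma 12.4 (p. 114)] -/
theorem integral_form_eq_zero_of_parabolaType (hγ : ContDiff ℝ 1 γ) (hper : Function.Periodic γ 1)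
    {α β α' β' : ℂ} (hdet : α * β' - α' * β ≠ 0) (g : ℂ[X])
    (hcurve : ∀ t, α' * γ t 0 + β' * γ t 1 = g.eval (α * γ t 0 + β * γ t 1))
    (A B : MvPolynomial (Fin 2) R) :
    (∫ t in (0:ℝ)..1, (aeval (γ t) A * deriv (fun s => γ s 0) t +
        aeval (γ t) B * deriv (fun s => γ s 1) t)) = 0 := by
  have h01 : (α * γ 0 0 + β * γ 0 1) = (α * γ 1 0 + β * γ 1 1) := by
    have h := hper 0
    rw [zero_add] at h
    rw [h]
  have hθ : ContDiff ℝ 1 fun s => α * γ s 0 + β * γ s 1 := by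
    simpa using contDiff_linear_loop hγ α β 0
  refine integral_form_eq_zero_of_param (θ := fun s => α * γ s 0 + β * γ s 1) hθ h01
    ![Polynomial.C (β' / (α * β' - α' * β)) * Polynomial.X -
        Polynomial.C (β / (α * β' - α' * β)) * g,
      Polynomial.C (α / (α * β' - α' * β)) * g -
        Polynomial.C (α' / (α * β' - α' * β)) * Polynomial.X] (fun t i => ?_) A B
  have h := hcurve t
  fin_cases i
  · simp only [Fin.zero_eta, Fin.isValue, Matrix.cons_val_zero, Polynomial.eval_sub,
      Polynomial.eval_mul, Polynomial.eval_C, Polynomial.eval_X]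
    rw [div_mul_eq_mul_div, div_mul_eq_mul_div, ← sub_div, eq_div_iff hdet]
    linear_combination (-β) * h
  · simp only [Fin.mk_one, Fin.isValue, Matrix.cons_val_one, Matrix.cons_val_zero,
      Polynomial.eval_sub, Polynomial.eval_mul, Polynomial.eval_C, Polynomial.eval_X]
    rw [div_mul_eq_mul_div, div_mul_eq_mul_div, ← sub_div, eq_div_iff hdet]
    linear_combination α * h


/-- **Loops on a parabola have zero complete periods**, curve given as `ν μ = P(θ)` with
`ν ≠ 0` (`θ = αx + βy`, `μ = α′x + β′y`, `αβ′ − α′β ≠ 0`, `P ∈ ℂ[s]`). [cite: HuberWustholz2022, Lemma 12.4 (p. 114)] -/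
theorem integral_form_eq_zero_of_parabolaType_mul (hγ : ContDiff ℝ 1 γ)
    (hper : Function.Periodic γ 1) {α β α' β' ν : ℂ} (hdet : α * β' - α' * β ≠ 0) (hν : ν ≠ 0)
    (P : ℂ[X]) (hcurve : ∀ t, ν * (α' * γ t 0 + β' * γ t 1) = P.eval (α * γ t 0 + β * γ t 1))
    (A B : MvPolynomial (Fin 2) R) :
    (∫ t in (0:ℝ)..1, (aeval (γ t) A * deriv (fun s => γ s 0) t +
        aeval (γ t) B * deriv (fun s => γ s 1) t)) = 0 := by
  refine integral_form_eq_zero_of_parabolaType hγ hper hdet (Polynomial.C ν⁻¹ * P) (fun t => ?_) A B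
  rw [Polynomial.eval_mul, Polynomial.eval_C, ← hcurve t, inv_mul_cancel_left₀ hν]

/-- **Loops on a graph `ν x = P(y)`** (`ν ≠ 0`, `P ∈ ℂ[s]`) have zero complete periods.
[cite: HuberWustholz2022, Lemma 12.4 (p. 114)] -/
theorem integral_form_eq_zero_of_graph'_mul (hγ : ContDiff ℝ 1 γ) (hper : Function.Periodic γ 1)
    {ν : ℂ} (hν : ν ≠ 0) (P : ℂ[X]) (hg : ∀ t, ν * γ t 0 = P.eval (γ t 1))
    (A B : MvPolynomial (Fin 2) R) :
    (∫ t in (0:ℝ)..1, (aeval (γ t) A * deriv (fun s => γ s 0) t +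
        aeval (γ t) B * deriv (fun s => γ s 1) t)) = 0 := by
  refine integral_form_eq_zero_of_graph' hγ hper (Polynomial.C ν⁻¹ * P) (fun t => ?_) A B
  rw [Polynomial.eval_mul, Polynomial.eval_C, ← hg t, inv_mul_cancel_left₀ hν]

end Degenerate


/-! ### Loops on a central conic `L₁ L₂ = E` over `ℚ̄` -/

section Central

open LaurentPolynomial IntermediateField

/-- Evaluating the affine Laurent polynomial `P T + Q T⁻¹ + R` at `T = w`. [folklore] -/
theorem laurent_eval₂_affine {K : Type*} [CommRing K] [Algebra K ℂ] (P Q R : K) (w : ℂˣ) :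
    LaurentPolynomial.eval₂ (algebraMap K ℂ) w
        (LaurentPolynomial.C P * T 1 + LaurentPolynomial.C Q * T (-1) + LaurentPolynomial.C R) =
      algebraMap K ℂ P * (w : ℂ) + algebraMap K ℂ Q * (w : ℂ)⁻¹ + algebraMap K ℂ R := by
  simp only [map_add, eval₂_C_mul_T, LaurentPolynomial.eval₂_C, zpow_one, zpow_neg_one,
    Units.val_inv_eq_inv_val]

/-- Evaluating the Laurent polynomial `P − Q T⁻²` at `T = w`. [folklore] -/
theorem laurent_eval₂_affine_deriv {K : Type*} [CommRing K] [Algebra K ℂ] (P Q : K) (w : ℂˣ) :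
    LaurentPolynomial.eval₂ (algebraMap K ℂ) w
        (LaurentPolynomial.C P - LaurentPolynomial.C Q * T (-2)) =
      algebraMap K ℂ P - algebraMap K ℂ Q * ((w : ℂ) ^ 2)⁻¹ := by
  simp only [map_sub, map_mul, LaurentPolynomial.eval₂_C, eval₂_T, zpow_neg, zpow_ofNat,
    Units.val_inv_eq_inv_val, Units.val_pow_eq_pow_val]

/-- **The residue of a polynomial form on a hyperbola `L₁ L₂ = E` (`E ≠ 0`) over `ℚ̄`.**  For
affine forms `Lⱼ = αⱼ x + βⱼ y + κⱼ` with algebraic coefficients, independent linear parts and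
`E ∈ ℚ̄ ∖ {0}`, and `A, B ∈ ℚ[x, y]`, there is ONE algebraic number `c ∈ ℚ̄` such that for every
closed `C¹` loop `γ` on `L₁ L₂ = E`

  `∮_γ (A dx + B dy) = c · wind(L₁ ∘ γ) · 2πi`:

in the coordinate `u = L₁` the curve is `ℂ*` (`L₂ = E u⁻¹`, `x, y` affine in `u, u⁻¹` over `ℚ̄`),
the form pulls back to a Laurent polynomial form over `ℚ̄` and `c` is its residue at `0`
(`integral_form_of_laurentParam`). [cite: HuberWustholz2022, Remark 13.10 (p. 125)] -/
theorem exists_residue_of_central (α₁ β₁ κ₁ α₂ β₂ κ₂ E : algebraicClosure ℚ ℂ)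
    (hdet : α₁ * β₂ - α₂ * β₁ ≠ 0) (hE : E ≠ 0) (A B : MvPolynomial (Fin 2) ℚ) :
    ∃ c : algebraicClosure ℚ ℂ, ∀ γ : ℝ → (Fin 2 → ℂ), ContDiff ℝ 1 γ →
      Function.Periodic γ 1 →
      (∀ t, ((α₁ : ℂ) * γ t 0 + β₁ * γ t 1 + κ₁) * ((α₂ : ℂ) * γ t 0 + β₂ * γ t 1 + κ₂) = E) →
      (∫ t in (0:ℝ)..1, (aeval (γ t) A * deriv (fun s => γ s 0) t +
          aeval (γ t) B * deriv (fun s => γ s 1) t)) =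
        (c : ℂ) * (wind (fun t => (α₁ : ℂ) * γ t 0 + β₁ * γ t 1 + κ₁) * (2 * π * I)) := by
  -- `δ = 1 / det`
  obtain ⟨δ, hδ⟩ : ∃ δ : algebraicClosure ℚ ℂ, δ * (α₁ * β₂ - α₂ * β₁) = 1 :=
    ⟨_, inv_mul_cancel₀ hdet⟩
  have hδ' : (δ : ℂ) * ((α₁ : ℂ) * β₂ - α₂ * β₁) = 1 := by exact_mod_cast hδ
  have hE' : ((E : algebraicClosure ℚ ℂ) : ℂ) ≠ 0 := by exact_mod_cast hE
  -- `x = P₀ u + Q₀ u⁻¹ + R₀`, `y = P₁ u + Q₁ u⁻¹ + R₁` on the curve, `u = L₁`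
  obtain ⟨Ψ, hΨ⟩ : ∃ Ψ : Fin 2 → (algebraicClosure ℚ ℂ)[T;T⁻¹], Ψ =
      ![LaurentPolynomial.C (β₂ * δ) * T 1 + LaurentPolynomial.C (-(β₁ * E * δ)) * T (-1) +
          LaurentPolynomial.C ((β₁ * κ₂ - β₂ * κ₁) * δ),
        LaurentPolynomial.C (-(α₂ * δ)) * T 1 + LaurentPolynomial.C (α₁ * E * δ) * T (-1) +
          LaurentPolynomial.C ((α₂ * κ₁ - α₁ * κ₂) * δ)] := ⟨_, rfl⟩
  obtain ⟨Ψ', hΨ'⟩ : ∃ Ψ' : Fin 2 → (algebraicClosure ℚ ℂ)[T;T⁻¹], Ψ' =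
      ![LaurentPolynomial.C (β₂ * δ) - LaurentPolynomial.C (-(β₁ * E * δ)) * T (-2),
        LaurentPolynomial.C (-(α₂ * δ)) - LaurentPolynomial.C (α₁ * E * δ) * T (-2)] := ⟨_, rfl⟩
  refine ⟨(MvPolynomial.aeval Ψ A * Ψ' 0 + MvPolynomial.aeval Ψ B * Ψ' 1).coeff (-1),
    fun γ hC hper hon => ?_⟩
  -- the coordinate `u = L₁` along the loop
  obtain ⟨u, hu⟩ : ∃ u : ℝ → ℂ, u = fun t => (α₁ : ℂ) * γ t 0 + β₁ * γ t 1 + κ₁ := ⟨_, rfl⟩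
  have hu1 : ContDiff ℝ 1 u := hu ▸ contDiff_linear_loop hC _ _ _
  have hu0 : ∀ t, u t ≠ 0 := by
    intro t h0
    apply hE'
    rw [← hon t]
    have h0' : (α₁ : ℂ) * γ t 0 + β₁ * γ t 1 + κ₁ = 0 := by rw [hu] at h0; exact h0
    rw [h0', zero_mul]
  have hu01 : u 0 = u 1 := by
    have h := hper 0
    rw [zero_add] at h
    simp only [hu, h]
  have hud : ∀ t, HasDerivAt u (deriv u t) t := fun t =>
    ((hu1.differentiable one_ne_zero) t).hasDerivAt
  -- the affine expressions of `x, y` in `u, w = u⁻¹` (pure ring identities from the relations)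
  have hxy : ∀ t, γ t 0 = ((β₂ * δ : algebraicClosure ℚ ℂ) : ℂ) * u t +
        ((-(β₁ * E * δ) : algebraicClosure ℚ ℂ) : ℂ) * (u t)⁻¹ +
        (((β₁ * κ₂ - β₂ * κ₁) * δ : algebraicClosure ℚ ℂ) : ℂ) ∧
      γ t 1 = ((-(α₂ * δ) : algebraicClosure ℚ ℂ) : ℂ) * u t +
        ((α₁ * E * δ : algebraicClosure ℚ ℂ) : ℂ) * (u t)⁻¹ +
        (((α₂ * κ₁ - α₁ * κ₂) * δ : algebraicClosure ℚ ℂ) : ℂ) := by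
    intro t
    have hrel := hon t
    have hudef : u t = (α₁ : ℂ) * γ t 0 + β₁ * γ t 1 + κ₁ := by rw [hu]
    have hw : (u t)⁻¹ * u t = 1 := inv_mul_cancel₀ (hu0 t)
    push_cast
    constructor
    · linear_combination (-(γ t 0)) * hδ' +
        ((δ : ℂ) * ((β₁ : ℂ) * κ₂ - β₂ * κ₁) + (δ : ℂ) * β₂ * u t -
          (δ : ℂ) * ((α₁ : ℂ) * β₂ - α₂ * β₁) * γ t 0) * hw +
        (-((δ : ℂ) * (u t)⁻¹ * β₁)) * hrel +
        (-((δ : ℂ) * (u t)⁻¹ * u t * β₂) -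
          (δ : ℂ) * (u t)⁻¹ * β₁ * ((α₂ : ℂ) * γ t 0 + β₂ * γ t 1 + κ₂)) * hudef
    · linear_combination (-(γ t 1)) * hδ' +
        ((δ : ℂ) * ((α₂ : ℂ) * κ₁ - α₁ * κ₂) - (δ : ℂ) * α₂ * u t -
          (δ : ℂ) * ((α₁ : ℂ) * β₂ - α₂ * β₁) * γ t 1) * hw +
        ((δ : ℂ) * (u t)⁻¹ * α₁) * hrel +
        ((δ : ℂ) * (u t)⁻¹ * u t * α₂ +
          (δ : ℂ) * (u t)⁻¹ * α₁ * ((α₂ : ℂ) * γ t 0 + β₂ * γ t 1 + κ₂)) * hudef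
  -- apply the Laurent engine
  have key := integral_form_of_laurentParam (γ := γ) hu1 hu0 hu01 Ψ Ψ'
    (fun t j => ?_) (fun t j => ?_) (map (algebraMap ℚ (algebraicClosure ℚ ℂ)) A)
    (map (algebraMap ℚ (algebraicClosure ℚ ℂ)) B)
  · simp only [aeval_map_algebraMap, IntermediateField.algebraMap_apply] at key
    rw [hu] at key
    exact key
  · -- `γ = Ψ(u)`
    fin_cases j
    · simp only [Fin.zero_eta, Fin.isValue]
      rw [(hxy t).1, hΨ]
      simp only [Matrix.cons_val_zero, laurent_eval₂_affine, IntermediateField.algebraMap_apply,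
        Units.val_mk0]
    · simp only [Fin.mk_one, Fin.isValue]
      rw [(hxy t).2, hΨ]
      simp only [Matrix.cons_val_one, Matrix.cons_val_zero, laurent_eval₂_affine,
        IntermediateField.algebraMap_apply, Units.val_mk0]
  · -- `γ′ = Ψ′(u) u′`
    have hd : ∀ P Q R : ℂ, HasDerivAt (fun s => P * u s + Q * (u s)⁻¹ + R)
        (P * deriv u t + Q * (-(deriv u t) / (u t) ^ 2)) t := fun P Q R =>
      (((hud t).const_mul P).add (((hud t).inv (hu0 t)).const_mul Q)).add_const R
    fin_cases j
    · have hfun : (fun s => γ s 0) = fun s => ((β₂ * δ : algebraicClosure ℚ ℂ) : ℂ) * u s +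
          ((-(β₁ * E * δ) : algebraicClosure ℚ ℂ) : ℂ) * (u s)⁻¹ +
          (((β₁ * κ₂ - β₂ * κ₁) * δ : algebraicClosure ℚ ℂ) : ℂ) := funext fun s => (hxy s).1
      simp only [Fin.zero_eta, Fin.isValue, hΨ', Matrix.cons_val_zero, laurent_eval₂_affine_deriv,
        IntermediateField.algebraMap_apply, Units.val_mk0]
      rw [hfun, (hd _ _ _).deriv, div_eq_mul_inv]
      ring
    · have hfun : (fun s => γ s 1) = fun s => ((-(α₂ * δ) : algebraicClosure ℚ ℂ) : ℂ) * u s +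
          ((α₁ * E * δ : algebraicClosure ℚ ℂ) : ℂ) * (u s)⁻¹ +
          (((α₂ * κ₁ - α₁ * κ₂) * δ : algebraicClosure ℚ ℂ) : ℂ) := funext fun s => (hxy s).2
      simp only [Fin.mk_one, Fin.isValue, hΨ', Matrix.cons_val_one, Matrix.cons_val_zero,
        laurent_eval₂_affine_deriv, IntermediateField.algebraMap_apply, Units.val_mk0]
      rw [hfun, (hd _ _ _).deriv, div_eq_mul_inv]
      ring

/-- **Central conics: the named fact holds on `L₁ L₂ = E` over `ℚ̄`.**  Let
`Lⱼ = αⱼ x + βⱼ y + κⱼ` (`j = 1, 2`) be affine forms with ALGEBRAIC coefficients and independent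
linear parts (`α₁β₂ − α₂β₁ ≠ 0`), `E ∈ ℚ̄`, and let the loops `γᵢ` lie on `L₁ L₂ = E` and avoid
the locus `L₁ = L₂ = 0`.  Then the complete period `S = Σᵢ nᵢ ∮_{γᵢ} (A dx + B dy)`
(`A, B ∈ ℚ[x, y]`) vanishes as soon as it is algebraic.  For `E = 0` (two crossing lines) every
loop stays on one line and all periods vanish; for `E ≠ 0` the curve is `𝔾_m` and
`S = c · (Σᵢ nᵢ wind(uᵢ)) · 2πi` with ONE algebraic residue `c ∈ ℚ̄`
(`exists_residue_of_central`), so Lindemann's theorem forces `S = 0` — the genus-`0` instance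
"transcendence of `π`" of Huber–Wüstholz, Thm. 13.9 / Cor. 13.13 (Remark 13.10).
[cite: HuberWustholz2022, Cor. 13.13 (p. 126) and Remark 13.10 (p. 125); Lindemann1882] -/
theorem completePeriods_eq_zero_of_central (α₁ β₁ κ₁ α₂ β₂ κ₂ E : algebraicClosure ℚ ℂ)
    (hdet : α₁ * β₂ - α₂ * β₁ ≠ 0) (A B : MvPolynomial (Fin 2) ℚ) (k : ℕ) (n : Fin k → ℤ)
    (γ : Fin k → ℝ → (Fin 2 → ℂ))
    (hγ : ∀ i, ContDiff ℝ 1 (γ i) ∧ Function.Periodic (γ i) 1 ∧ ∀ t,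
      ((α₁ : ℂ) * γ i t 0 + β₁ * γ i t 1 + κ₁) * ((α₂ : ℂ) * γ i t 0 + β₂ * γ i t 1 + κ₂) = E ∧
      ¬(((α₁ : ℂ) * γ i t 0 + β₁ * γ i t 1 + κ₁) = 0 ∧
        ((α₂ : ℂ) * γ i t 0 + β₂ * γ i t 1 + κ₂) = 0))
    (halg : IsAlgebraic ℚ (∑ i, (n i : ℂ) * ∫ t in (0:ℝ)..1,
      (aeval (γ i t) A * deriv (fun s => γ i s 0) t +
        aeval (γ i t) B * deriv (fun s => γ i s 1) t))) :
    (∑ i, (n i : ℂ) * ∫ t in (0:ℝ)..1,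
      (aeval (γ i t) A * deriv (fun s => γ i s 0) t +
        aeval (γ i t) B * deriv (fun s => γ i s 1) t)) = 0 := by
  by_cases hE : E = 0
  · -- two crossing lines: each loop lies on one of them (rows of an invertible matrix are ≠ 0)
    have hrow₁ : ¬((α₁ : ℂ) = 0 ∧ (β₁ : ℂ) = 0) := by
      rintro ⟨h1, h2⟩
      apply hdet
      have h1' : α₁ = 0 := by exact_mod_cast h1
      have h2' : β₁ = 0 := by exact_mod_cast h2
      rw [h1', h2', zero_mul, mul_zero, sub_zero]
    have hrow₂ : ¬((α₂ : ℂ) = 0 ∧ (β₂ : ℂ) = 0) := by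
      rintro ⟨h1, h2⟩
      apply hdet
      have h1' : α₂ = 0 := by exact_mod_cast h1
      have h2' : β₂ = 0 := by exact_mod_cast h2
      rw [h1', h2', zero_mul, mul_zero, sub_zero]
    refine Finset.sum_eq_zero fun i _ => ?_
    obtain ⟨hC1, hper, hon⟩ := hγ i
    have hmul : ∀ t, ((α₁ : ℂ) * γ i t 0 + β₁ * γ i t 1 + κ₁) *
        ((α₂ : ℂ) * γ i t 0 + β₂ * γ i t 1 + κ₂) = 0 := fun t => by
      rw [(hon t).1, hE]
      rfl
    rcases forall_or_forall_of_mul_eq_zero (continuous_linear_loop hC1 _ _ _)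
        (continuous_linear_loop hC1 _ _ _) hmul (fun t => (hon t).2) with h | h
    · rw [integral_form_eq_zero_of_line hC1 hper hrow₁ h A B, mul_zero]
    · rw [integral_form_eq_zero_of_line hC1 hper hrow₂ h A B, mul_zero]
  · -- the hyperbola `L₁ L₂ = E`, `E ≠ 0`: one algebraic residue for all loops
    obtain ⟨c, hc⟩ := exists_residue_of_central α₁ β₁ κ₁ α₂ β₂ κ₂ E hdet hE A B
    have hI : ∀ i, (∫ t in (0:ℝ)..1, (aeval (γ i t) A * deriv (fun s => γ i s 0) t +
        aeval (γ i t) B * deriv (fun s => γ i s 1) t)) =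
        (c : ℂ) * (wind (fun t => (α₁ : ℂ) * γ i t 0 + β₁ * γ i t 1 + κ₁) * (2 * π * I)) :=
      fun i => hc (γ i) (hγ i).1 (hγ i).2.1 fun t => ((hγ i).2.2 t).1
    -- `S = (c · W) · 2πi` with `W = Σ nᵢ wind(uᵢ) ∈ ℤ`
    have hS : (∑ i, (n i : ℂ) * ∫ t in (0:ℝ)..1, (aeval (γ i t) A * deriv (fun s => γ i s 0) t +
        aeval (γ i t) B * deriv (fun s => γ i s 1) t)) =
        ((c : ℂ) * ((∑ i, n i * wind (fun t => (α₁ : ℂ) * γ i t 0 + β₁ * γ i t 1 + κ₁) : ℤ) :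
          ℂ)) * (2 * π * I) := by
      push_cast
      rw [Finset.mul_sum, Finset.sum_mul]
      refine Finset.sum_congr rfl fun i _ => ?_
      rw [hI i]
      ring
    rw [hS] at halg ⊢
    have halgc : IsAlgebraic ℚ ((c : ℂ) *
        ((∑ i, n i * wind (fun t => (α₁ : ℂ) * γ i t 0 + β₁ * γ i t 1 + κ₁) : ℤ) : ℂ)) := by
      refine (mem_algebraicClosure_iff.1 c.2).mul ?_
      rw [← map_intCast (algebraMap ℚ ℂ)]
      exact isAlgebraic_algebraMap _
    rw [eq_zero_of_isAlgebraic_mul_two_pi_I halgc halg, zero_mul]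

end Central


/-! ### Conics over `ℚ`: normal form and evaluation -/

section NormalForm

/-- A monomial in two variables. [folklore] -/
theorem monomial_fin_two (v : Fin 2 →₀ ℕ) (r : ℚ) :
    monomial v r = C r * X 0 ^ (v 0) * X 1 ^ (v 1) := by
  have hv : v = Finsupp.single 0 (v 0) + Finsupp.single 1 (v 1) := by
    ext i
    fin_cases i <;> simp
  rw [C_mul_X_pow_eq_monomial, X_pow_eq_monomial, monomial_mul, mul_one, ← hv]

/-- **A polynomial `p ∈ ℚ[x, y]` of total degree `≤ 2` is a conic**
`a x² + b xy + c y² + d x + e y + f`. [folklore] -/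
theorem exists_eq_conic_of_totalDegree_le_two {p : MvPolynomial (Fin 2) ℚ}
    (hp : p.totalDegree ≤ 2) :
    ∃ a b c d e f : ℚ, p = C a * X 0 ^ 2 + C b * (X 0 * X 1) + C c * X 1 ^ 2 + C d * X 0 +
      C e * X 1 + C f := by
  rw [p.as_sum]
  refine Finset.sum_induction _ (fun q : MvPolynomial (Fin 2) ℚ => ∃ a b c d e f : ℚ,
      q = C a * X 0 ^ 2 + C b * (X 0 * X 1) + C c * X 1 ^ 2 + C d * X 0 + C e * X 1 + C f)
    ?_ ?_ ?_
  · rintro q q' ⟨a, b, c, d, e, f, rfl⟩ ⟨a', b', c', d', e', f', rfl⟩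
    exact ⟨a + a', b + b', c + c', d + d', e + e', f + f', by simp only [map_add]; ring⟩
  · exact ⟨0, 0, 0, 0, 0, 0, by simp⟩
  · intro v hv
    have hdeg : v 0 + v 1 ≤ 2 := by
      have h := MvPolynomial.le_totalDegree hv
      rw [Finsupp.sum_fintype _ _ (fun _ => rfl), Fin.sum_univ_two] at h
      exact h.trans hp
    rw [monomial_fin_two]
    generalize coeff v p = r
    generalize hi : v 0 = i at hdeg
    generalize hj : v 1 = j at hdeg
    have hcases : (i = 0 ∧ j = 0) ∨ (i = 1 ∧ j = 0) ∨ (i = 0 ∧ j = 1) ∨ (i = 2 ∧ j = 0) ∨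
        (i = 1 ∧ j = 1) ∨ (i = 0 ∧ j = 2) := by omega
    rcases hcases with ⟨rfl, rfl⟩ | ⟨rfl, rfl⟩ | ⟨rfl, rfl⟩ | ⟨rfl, rfl⟩ | ⟨rfl, rfl⟩ | ⟨rfl, rfl⟩
    · exact ⟨0, 0, 0, 0, 0, r, by simp⟩
    · exact ⟨0, 0, 0, r, 0, 0, by simp⟩
    · exact ⟨0, 0, 0, 0, r, 0, by simp⟩
    · exact ⟨r, 0, 0, 0, 0, 0, by simp⟩
    · exact ⟨0, r, 0, 0, 0, 0, by simp [mul_assoc]⟩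
    · exact ⟨0, 0, r, 0, 0, 0, by simp⟩

/-- Evaluating a conic. [folklore] -/
theorem aeval_conic (a b c d e f : ℚ) (z : Fin 2 → ℂ) :
    aeval z (C a * X 0 ^ 2 + C b * (X 0 * X 1) + C c * X 1 ^ 2 + C d * X 0 + C e * X 1 + C f :
        MvPolynomial (Fin 2) ℚ) =
      algebraMap ℚ ℂ a * z 0 ^ 2 + algebraMap ℚ ℂ b * (z 0 * z 1) + algebraMap ℚ ℂ c * z 1 ^ 2 +
        algebraMap ℚ ℂ d * z 0 + algebraMap ℚ ℂ e * z 1 + algebraMap ℚ ℂ f := by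
  simp only [map_add, map_mul, map_pow, aeval_C, aeval_X]

/-- The `x`-derivative of a conic. [folklore] -/
theorem aeval_pderiv_zero_conic (a b c d e f : ℚ) (z : Fin 2 → ℂ) :
    aeval z (pderiv 0 (C a * X 0 ^ 2 + C b * (X 0 * X 1) + C c * X 1 ^ 2 + C d * X 0 + C e * X 1 +
        C f : MvPolynomial (Fin 2) ℚ)) =
      2 * algebraMap ℚ ℂ a * z 0 + algebraMap ℚ ℂ b * z 1 + algebraMap ℚ ℂ d := by
  simp only [map_add, Derivation.leibniz, Derivation.leibniz_pow, pderiv_C, pderiv_X_self,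
    pderiv_X_of_ne (R := ℚ) (i := (0 : Fin 2)) (j := (1 : Fin 2)) (by decide), smul_eq_mul, mul_zero, add_zero, mul_one,
    map_mul, map_pow, map_natCast, aeval_C, aeval_X, nsmul_eq_mul, map_zero]
  ring

/-- The `y`-derivative of a conic. [folklore] -/
theorem aeval_pderiv_one_conic (a b c d e f : ℚ) (z : Fin 2 → ℂ) :
    aeval z (pderiv 1 (C a * X 0 ^ 2 + C b * (X 0 * X 1) + C c * X 1 ^ 2 + C d * X 0 + C e * X 1 +
        C f : MvPolynomial (Fin 2) ℚ)) =
      algebraMap ℚ ℂ b * z 0 + 2 * algebraMap ℚ ℂ c * z 1 + algebraMap ℚ ℂ e := by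
  simp only [map_add, Derivation.leibniz, Derivation.leibniz_pow, pderiv_C, pderiv_X_self,
    pderiv_X_of_ne (R := ℚ) (i := (1 : Fin 2)) (j := (0 : Fin 2)) (by decide), smul_eq_mul, mul_zero, add_zero, mul_one,
    map_mul, map_pow, map_natCast, aeval_C, aeval_X, nsmul_eq_mul, map_zero]
  ring

end NormalForm


/-! ### Conics over `ℚ`: the case analysis -/

section Conics

open IntermediateField

/-- **Reduction of a conic with non-degenerate quadratic part to a central conic over `ℚ̄`.**
If the quadratic part of `p = a x² + b xy + c y² + d x + e y + f ∈ ℚ[x, y]` factors over `ℚ̄`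
as `(α₁ x + β₁ y)(α₂ x + β₂ y)` with `α₁β₂ − α₂β₁ ≠ 0`, then `p = L₁ L₂ − E` for affine forms
`Lⱼ = αⱼ x + βⱼ y + κⱼ` and `E ∈ ℚ̄` (solve `κ₂ (α₁, β₁) + κ₁ (α₂, β₂) = (d, e)`), the smooth
locus of `p = 0` avoids `L₁ = L₂ = 0` (`∇p = L₂ ∇L₁ + L₁ ∇L₂`), and
`completePeriods_eq_zero_of_central` applies. [cite: HuberWustholz2022, Cor. 13.13 (p. 126), Remark 13.10 (p. 125)] -/
theorem completePeriods_eq_zero_of_factoredConic (a b c d e f : ℚ)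
    (α₁ β₁ α₂ β₂ : algebraicClosure ℚ ℂ) (h1 : α₁ * α₂ = algebraMap ℚ _ a)
    (h2 : α₁ * β₂ + β₁ * α₂ = algebraMap ℚ _ b) (h3 : β₁ * β₂ = algebraMap ℚ _ c)
    (hdet : α₁ * β₂ - α₂ * β₁ ≠ 0) (A B : MvPolynomial (Fin 2) ℚ) (k : ℕ) (n : Fin k → ℤ)
    (γ : Fin k → ℝ → (Fin 2 → ℂ))
    (hγ : ∀ i, ContDiff ℝ 1 (γ i) ∧ Function.Periodic (γ i) 1 ∧ ∀ t,
      algebraMap ℚ ℂ a * γ i t 0 ^ 2 + algebraMap ℚ ℂ b * (γ i t 0 * γ i t 1) +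
        algebraMap ℚ ℂ c * γ i t 1 ^ 2 + algebraMap ℚ ℂ d * γ i t 0 +
        algebraMap ℚ ℂ e * γ i t 1 + algebraMap ℚ ℂ f = 0 ∧
      ¬(2 * algebraMap ℚ ℂ a * γ i t 0 + algebraMap ℚ ℂ b * γ i t 1 + algebraMap ℚ ℂ d = 0 ∧
        algebraMap ℚ ℂ b * γ i t 0 + 2 * algebraMap ℚ ℂ c * γ i t 1 + algebraMap ℚ ℂ e = 0))
    (halg : IsAlgebraic ℚ (∑ i, (n i : ℂ) * ∫ t in (0:ℝ)..1,
      (aeval (γ i t) A * deriv (fun s => γ i s 0) t +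
        aeval (γ i t) B * deriv (fun s => γ i s 1) t))) :
    (∑ i, (n i : ℂ) * ∫ t in (0:ℝ)..1,
      (aeval (γ i t) A * deriv (fun s => γ i s 0) t +
        aeval (γ i t) B * deriv (fun s => γ i s 1) t)) = 0 := by
  obtain ⟨δ, hδ⟩ : ∃ δ : algebraicClosure ℚ ℂ, δ * (α₁ * β₂ - α₂ * β₁) = 1 :=
    ⟨_, inv_mul_cancel₀ hdet⟩
  obtain ⟨κ₁, hκ₁⟩ : ∃ κ₁ : algebraicClosure ℚ ℂ,
      κ₁ = (algebraMap ℚ _ e * α₁ - algebraMap ℚ _ d * β₁) * δ := ⟨_, rfl⟩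
  obtain ⟨κ₂, hκ₂⟩ : ∃ κ₂ : algebraicClosure ℚ ℂ,
      κ₂ = (algebraMap ℚ _ d * β₂ - algebraMap ℚ _ e * α₂) * δ := ⟨_, rfl⟩
  have hk1 : κ₂ * α₁ + κ₁ * α₂ = algebraMap ℚ _ d := by
    rw [hκ₁, hκ₂]
    linear_combination (algebraMap ℚ (algebraicClosure ℚ ℂ) d) * hδ
  have hk2 : κ₂ * β₁ + κ₁ * β₂ = algebraMap ℚ _ e := by
    rw [hκ₁, hκ₂]
    linear_combination (algebraMap ℚ (algebraicClosure ℚ ℂ) e) * hδ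
  -- cast the relations to `ℂ`
  have h1' : (α₁ : ℂ) * α₂ = algebraMap ℚ ℂ a := by
    simpa using congrArg (algebraMap (algebraicClosure ℚ ℂ) ℂ) h1
  have h2' : (α₁ : ℂ) * β₂ + β₁ * α₂ = algebraMap ℚ ℂ b := by
    simpa using congrArg (algebraMap (algebraicClosure ℚ ℂ) ℂ) h2
  have h3' : (β₁ : ℂ) * β₂ = algebraMap ℚ ℂ c := by
    simpa using congrArg (algebraMap (algebraicClosure ℚ ℂ) ℂ) h3
  have hk1' : (κ₂ : ℂ) * α₁ + κ₁ * α₂ = algebraMap ℚ ℂ d := by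
    simpa using congrArg (algebraMap (algebraicClosure ℚ ℂ) ℂ) hk1
  have hk2' : (κ₂ : ℂ) * β₁ + κ₁ * β₂ = algebraMap ℚ ℂ e := by
    simpa using congrArg (algebraMap (algebraicClosure ℚ ℂ) ℂ) hk2
  have hE' : ((κ₁ * κ₂ - algebraMap ℚ (algebraicClosure ℚ ℂ) f : algebraicClosure ℚ ℂ) : ℂ) =
      (κ₁ : ℂ) * κ₂ - algebraMap ℚ ℂ f := by
    push_cast
    rfl
  refine completePeriods_eq_zero_of_central α₁ β₁ κ₁ α₂ β₂ κ₂
    (κ₁ * κ₂ - algebraMap ℚ (algebraicClosure ℚ ℂ) f) hdet A B k n γ (fun i => ?_) halg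
  refine ⟨(hγ i).1, (hγ i).2.1, fun t => ⟨?_, ?_⟩⟩
  · -- `L₁ L₂ = E` on the curve
    have hon := ((hγ i).2.2 t).1
    rw [hE']
    linear_combination hon + (γ i t 0 ^ 2) * h1' + (γ i t 0 * γ i t 1) * h2' +
      (γ i t 1 ^ 2) * h3' + (γ i t 0) * hk1' + (γ i t 1) * hk2'
  · -- the smooth locus avoids `L₁ = L₂ = 0`
    rintro ⟨hL1, hL2⟩
    refine ((hγ i).2.2 t).2 ⟨?_, ?_⟩
    · linear_combination (-(2 * γ i t 0)) * h1' + (-(γ i t 1)) * h2' + (-1 : ℂ) * hk1' +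
        (α₁ : ℂ) * hL2 + (α₂ : ℂ) * hL1
    · linear_combination (-(γ i t 0)) * h2' + (-(2 * γ i t 1)) * h3' + (-1 : ℂ) * hk2' +
        (β₁ : ℂ) * hL2 + (β₂ : ℂ) * hL1

/-- **The named fact on a conic `a x² + b xy + c y² + d x + e y + f = 0` over `ℚ`**, hypotheses
unpacked into complex equations (on-curve and smoothness).  Cases: no quadratic part — a
line (`integral_form_eq_zero_of_line`) or an empty smooth locus; discriminant `b² − 4ac = 0` —
a parabola (`…_of_parabolaType`, `…_of_graph'`) or parallel lines / a double line
(`…_of_parallelType`): all periods vanish; `b² − 4ac ≠ 0` — the quadratic part factors over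
`ℚ(√(b² − 4ac)) ⊂ ℚ̄` and `completePeriods_eq_zero_of_factoredConic` applies (Lindemann).
[cite: HuberWustholz2022, Cor. 13.13 (p. 126), Remark 13.10 (p. 125); Lindemann1882] -/
theorem completePeriods_eq_zero_of_conic (a b c d e f : ℚ) (A B : MvPolynomial (Fin 2) ℚ)
    (k : ℕ) (n : Fin k → ℤ) (γ : Fin k → ℝ → (Fin 2 → ℂ))
    (hγ : ∀ i, ContDiff ℝ 1 (γ i) ∧ Function.Periodic (γ i) 1 ∧ ∀ t,
      algebraMap ℚ ℂ a * γ i t 0 ^ 2 + algebraMap ℚ ℂ b * (γ i t 0 * γ i t 1) +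
        algebraMap ℚ ℂ c * γ i t 1 ^ 2 + algebraMap ℚ ℂ d * γ i t 0 +
        algebraMap ℚ ℂ e * γ i t 1 + algebraMap ℚ ℂ f = 0 ∧
      ¬(2 * algebraMap ℚ ℂ a * γ i t 0 + algebraMap ℚ ℂ b * γ i t 1 + algebraMap ℚ ℂ d = 0 ∧
        algebraMap ℚ ℂ b * γ i t 0 + 2 * algebraMap ℚ ℂ c * γ i t 1 + algebraMap ℚ ℂ e = 0))
    (halg : IsAlgebraic ℚ (∑ i, (n i : ℂ) * ∫ t in (0:ℝ)..1,
      (aeval (γ i t) A * deriv (fun s => γ i s 0) t +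
        aeval (γ i t) B * deriv (fun s => γ i s 1) t))) :
    (∑ i, (n i : ℂ) * ∫ t in (0:ℝ)..1,
      (aeval (γ i t) A * deriv (fun s => γ i s 0) t +
        aeval (γ i t) B * deriv (fun s => γ i s 1) t)) = 0 := by
  have hinj : Function.Injective (algebraMap ℚ ℂ) := (algebraMap ℚ ℂ).injective
  have hinjK : Function.Injective (algebraMap ℚ (algebraicClosure ℚ ℂ)) :=
    (algebraMap ℚ (algebraicClosure ℚ ℂ)).injective
  by_cases hQ : a = 0 ∧ b = 0 ∧ c = 0
  · -- no quadratic part: a line, or an empty smooth locus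
    obtain ⟨rfl, rfl, rfl⟩ := hQ
    refine Finset.sum_eq_zero fun i _ => ?_
    obtain ⟨hC1, hper, hon⟩ := hγ i
    by_cases hde : d = 0 ∧ e = 0
    · obtain ⟨rfl, rfl⟩ := hde
      exact absurd ⟨by simp, by simp⟩ (hon 0).2
    · have hde' : ¬(algebraMap ℚ ℂ d = 0 ∧ algebraMap ℚ ℂ e = 0) := by
        rwa [map_eq_zero_iff _ hinj, map_eq_zero_iff _ hinj]
      rw [integral_form_eq_zero_of_line hC1 hper hde' (κ := algebraMap ℚ ℂ f) (fun t => ?_) A B,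
        mul_zero]
      have h := (hon t).1
      simp only [map_zero, zero_mul, zero_add] at h
      exact h
  by_cases hD : b ^ 2 - 4 * a * c = 0
  · -- parabola type: the quadratic part is a constant times the square of a linear form
    have hD' : algebraMap ℚ ℂ b ^ 2 - 4 * algebraMap ℚ ℂ a * algebraMap ℚ ℂ c = 0 := by
      simpa using congrArg (algebraMap ℚ ℂ) hD
    by_cases ha : a = 0
    · -- then `b = 0`, `c ≠ 0`: `p = c y² + e y + d x + f`
      subst ha
      have hb : b = 0 := by simpa using hD
      subst hb
      have hc : c ≠ 0 := fun h => hQ ⟨rfl, rfl, h⟩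
      have hc' : algebraMap ℚ ℂ c ≠ 0 := (map_ne_zero_iff _ hinj).2 hc
      refine Finset.sum_eq_zero fun i _ => ?_
      obtain ⟨hC1, hper, hon⟩ := hγ i
      simp only [map_zero, zero_mul, zero_add, mul_zero] at hon
      by_cases hd : d = 0
      · -- horizontal parallel lines / double line `c y² + e y + f = 0`
        subst hd
        simp only [map_zero, zero_mul, add_zero] at hon
        rw [integral_form_eq_zero_of_parallelType hC1 hper (α := 0) (β := 1) (l := algebraMap ℚ ℂ c)
          (m := algebraMap ℚ ℂ e) (f₀ := algebraMap ℚ ℂ f) (by simp) hc' (fun t => ?_)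
          (fun t h => ?_) A B, mul_zero]
        · linear_combination (hon t).1
        · refine (hon t).2 ⟨trivial, ?_⟩
          linear_combination h
      · -- the parabola `d x = -(c y² + e y + f)`, a graph over the `y`-axis
        have hd' : algebraMap ℚ ℂ d ≠ 0 := (map_ne_zero_iff _ hinj).2 hd
        rw [integral_form_eq_zero_of_graph'_mul hC1 hper hd'
          (-(Polynomial.C (algebraMap ℚ ℂ c) * Polynomial.X ^ 2 +
            Polynomial.C (algebraMap ℚ ℂ e) * Polynomial.X + Polynomial.C (algebraMap ℚ ℂ f)))
          (fun t => ?_) A B, mul_zero]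
        simp only [Polynomial.eval_neg, Polynomial.eval_add, Polynomial.eval_mul,
          Polynomial.eval_C, Polynomial.eval_pow, Polynomial.eval_X]
        linear_combination (hon t).1
    · -- `a ≠ 0`: `ℓ = 2a x + b y`, `4a p = ℓ² + 2d ℓ + ν y + 4af`, `ν = 4ae - 2bd`
      have ha' : algebraMap ℚ ℂ a ≠ 0 := (map_ne_zero_iff _ hinj).2 ha
      refine Finset.sum_eq_zero fun i _ => ?_
      obtain ⟨hC1, hper, hon⟩ := hγ i
      by_cases hν : 4 * a * e - 2 * b * d = 0
      · -- parallel lines / double line in the direction of `ℓ`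
        have hν' : 4 * algebraMap ℚ ℂ a * algebraMap ℚ ℂ e -
            2 * algebraMap ℚ ℂ b * algebraMap ℚ ℂ d = 0 := by
          simpa using congrArg (algebraMap ℚ ℂ) hν
        rw [integral_form_eq_zero_of_parallelType hC1 hper (α := 2 * algebraMap ℚ ℂ a)
          (β := algebraMap ℚ ℂ b) (l := 1) (m := 2 * algebraMap ℚ ℂ d)
          (f₀ := 4 * algebraMap ℚ ℂ a * algebraMap ℚ ℂ f) (fun h => ha' (by
            simpa using h.1)) one_ne_zero (fun t => ?_) (fun t h => ?_) A B, mul_zero]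
        · linear_combination (4 * algebraMap ℚ ℂ a) * (hon t).1 + (γ i t 1 ^ 2) * hD' -
            (γ i t 1) * hν'
        · refine (hon t).2 ⟨?_, ?_⟩
          · linear_combination h / 2
          · have h2 : (2 * algebraMap ℚ ℂ a) * (algebraMap ℚ ℂ b * γ i t 0 +
                2 * algebraMap ℚ ℂ c * γ i t 1 + algebraMap ℚ ℂ e) = 0 := by
              linear_combination (algebraMap ℚ ℂ b / 2) * h - (γ i t 1) * hD' +
                (1 / 2 : ℂ) * hν'
            exact (mul_eq_zero.1 h2).resolve_left (mul_ne_zero two_ne_zero ha')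
      · -- a genuine parabola: `ν y = -(ℓ² + 2d ℓ + 4af)` in the affine coordinates `(ℓ, y)`
        have hν' : 4 * algebraMap ℚ ℂ a * algebraMap ℚ ℂ e -
            2 * algebraMap ℚ ℂ b * algebraMap ℚ ℂ d ≠ 0 := by
          intro h
          apply hν
          apply hinj
          simpa using h
        rw [integral_form_eq_zero_of_parabolaType_mul hC1 hper (α := 2 * algebraMap ℚ ℂ a)
          (β := algebraMap ℚ ℂ b) (α' := 0) (β' := 1) (by simpa using ha') hν'
          (-(Polynomial.X ^ 2 + Polynomial.C (2 * algebraMap ℚ ℂ d) * Polynomial.X +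
            Polynomial.C (4 * algebraMap ℚ ℂ a * algebraMap ℚ ℂ f))) (fun t => ?_) A B, mul_zero]
        simp only [Polynomial.eval_neg, Polynomial.eval_add, Polynomial.eval_mul,
          Polynomial.eval_C, Polynomial.eval_pow, Polynomial.eval_X, zero_mul, zero_add, one_mul]
        linear_combination (4 * algebraMap ℚ ℂ a) * (hon t).1 + (γ i t 1 ^ 2) * hD'
  · -- central type: the quadratic part factors over `ℚ(s)`, `s² = b² - 4ac ≠ 0`
    obtain ⟨s, hs⟩ := IsAlgClosed.exists_eq_mul_self (algebraMap ℚ ℂ (b ^ 2 - 4 * a * c))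
    have hs_alg : IsAlgebraic ℚ s := by
      refine IsAlgebraic.of_pow two_pos ?_
      rw [sq, ← hs]
      exact isAlgebraic_algebraMap _
    have hsK : (⟨s, mem_algebraicClosure_iff.2 hs_alg⟩ : algebraicClosure ℚ ℂ) *
        ⟨s, mem_algebraicClosure_iff.2 hs_alg⟩ = algebraMap ℚ _ (b ^ 2 - 4 * a * c) := by
      apply Subtype.ext
      show s * s = algebraMap ℚ ℂ (b ^ 2 - 4 * a * c)
      exact hs.symm
    set 𝕤 : algebraicClosure ℚ ℂ := ⟨s, mem_algebraicClosure_iff.2 hs_alg⟩ with h𝕤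
    have hs0 : 𝕤 ≠ 0 := by
      intro h0
      apply hD
      apply hinjK
      rw [← hsK, h0, zero_mul, map_zero]
    by_cases ha : a = 0
    · -- `a = 0`, `b ≠ 0`: `Q = y (b x + c y)`
      subst ha
      have hb : b ≠ 0 := by
        intro h
        apply hD
        rw [h]
        ring
      refine completePeriods_eq_zero_of_factoredConic 0 b c d e f 0 1 (algebraMap ℚ _ b)
        (algebraMap ℚ _ c) (by simp) (by simp) (by simp) ?_ A B k n γ hγ halg
      simpa using (map_ne_zero_iff _ hinjK).2 hb
    · -- `a ≠ 0`: `Q = (a x + (b - s)/2 · y)(x + (b + s)/(2a) · y)`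
      have haK : algebraMap ℚ (algebraicClosure ℚ ℂ) a ≠ 0 := (map_ne_zero_iff _ hinjK).2 ha
      have hsK' : 𝕤 * 𝕤 = algebraMap ℚ _ b ^ 2 - 4 * algebraMap ℚ _ a * algebraMap ℚ _ c := by
        rw [hsK]
        simp
      refine completePeriods_eq_zero_of_factoredConic a b c d e f (algebraMap ℚ _ a)
        ((algebraMap ℚ _ b - 𝕤) / 2) 1 ((algebraMap ℚ _ b + 𝕤) / (2 * algebraMap ℚ _ a))
        (by simp) ?_ ?_ ?_ A B k n γ hγ halg
      · field_simp
        ring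
      · rw [div_mul_div_comm, div_eq_iff (by simpa using haK)]
        linear_combination (-1 : algebraicClosure ℚ ℂ) * hsK'
      · field_simp
        intro h
        apply hs0
        linear_combination h

end Conics

end ClosedPathPeriods

/-! ### The named fact in total degree `≤ 2` -/

/-- **The conic slice of the named fact is a theorem**:
`completePlaneCurvePeriods_zero_or_transcendental` holds for every `p ∈ ℚ[x, y]` of total
degree `≤ 2`, unconditionally.  For `A, B ∈ ℚ[x, y]`, closed `C¹` loops `γᵢ` of period `1` in
the smooth locus of the conic `p = 0` and `nᵢ ∈ ℤ`, the complete period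
`S = Σᵢ nᵢ ∮_{γᵢ} (A dx + B dy)` vanishes as soon as it is algebraic: on lines, parabolas and
pairs of lines all complete periods vanish (the components are `≅ 𝔸¹` or `𝔸¹ ∖ pt` carrying
only exact polynomial forms), and on a central conic `S ∈ ℚ̄ · π` (one residue at each of the
two points at infinity), so Lindemann's theorem (`transcendental_pi_holds`) concludes — e.g. the
area `∮ x dy = π/√(ac)` of the ellipse `a x² + c y² = 1` (`a, c ∈ ℚ_{>0}`) is transcendental.
This is the full degree-`2` (genus-`0`) content of Huber–Wüstholz, Thm. 13.9 / Cor. 13.13 (their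
Remark 13.10: in genus `0` the theorem is the transcendence of `π`); from degree `3` on (elliptic
curves) the fact needs Schneider's theorem and, for the mixed periods of punctured curves,
Wüstholz's analytic subgroup theorem, and stays a named fact. [cite: HuberWustholz2022, Cor. 13.13 (p. 126) and Remark 13.10 (p. 125); Lindemann1882] -/
theorem completePlaneCurvePeriods_zero_or_transcendental_of_totalDegree_le_two
    (p A B : MvPolynomial (Fin 2) ℚ) (hp : p.totalDegree ≤ 2) (k : ℕ) (n : Fin k → ℤ)
    (γ : Fin k → ℝ → (Fin 2 → ℂ))
    (hγ : ∀ i, ContDiff ℝ 1 (γ i) ∧ Function.Periodic (γ i) 1 ∧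
      ∀ t, aeval (γ i t) p = 0 ∧ ∃ j, aeval (γ i t) (pderiv j p) ≠ 0)
    (halg : IsAlgebraic ℚ (∑ i, (n i : ℂ) * ∫ t in (0:ℝ)..1,
      (aeval (γ i t) A * deriv (fun s => γ i s 0) t +
        aeval (γ i t) B * deriv (fun s => γ i s 1) t))) :
    (∑ i, (n i : ℂ) * ∫ t in (0:ℝ)..1,
      (aeval (γ i t) A * deriv (fun s => γ i s 0) t +
        aeval (γ i t) B * deriv (fun s => γ i s 1) t)) = 0 := by
  obtain ⟨a, b, c, d, e, f, rfl⟩ := ClosedPathPeriods.exists_eq_conic_of_totalDegree_le_two hp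
  refine ClosedPathPeriods.completePeriods_eq_zero_of_conic a b c d e f A B k n γ (fun i => ?_) halg
  refine ⟨(hγ i).1, (hγ i).2.1, fun t => ⟨?_, ?_⟩⟩
  · rw [← ClosedPathPeriods.aeval_conic]
    exact ((hγ i).2.2 t).1
  · rintro ⟨h0, h1⟩
    obtain ⟨j, hj⟩ := ((hγ i).2.2 t).2
    fin_cases j
    · exact hj (by rw [Fin.zero_eta, ClosedPathPeriods.aeval_pderiv_zero_conic]; exact h0)
    · exact hj (by rw [Fin.mk_one, ClosedPathPeriods.aeval_pderiv_one_conic]; exact h1)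


end Literature.NumberTheory.Transcendental

end
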